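import Summits.QuantumFields.GaugeBoot.ClassBNegativeCouplingShift
import Summits.QuantumFields.GaugeBoot.CutLoopCharacterPositivity
import Summits.QuantumFields.GaugeBoot.ClassBLimitPoints
import Literature.MathematicalPhysics.QuantumLattice.LatticeGaugeDLRLimitPointsProofs
import HarnessLib

/-!
# Class B is EMPTY at every `β < 0`: the infinite-volume bootstrap axioms (translation
invariance + one-link Schwinger–Dyson + diagonal RP) are inconsistent at negative coupling
(gauge-boot, task L3(α); part 2/2)

HONEST FRAMING (cell `pub-gaugeboot`, page 1 of every file): the venture produces certified bounds
on lattice expectations at stated coupling, gauge group, dimension and torus size; NOT a mass gap,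
NOT a continuum limit, NOT a string tension; NOT Yang–Mills-summit-bearing (barriers
`FixedCouplingUltralocality`, `PerturbativeInvisibility`). This module is a structural statement
about the Class-B column (SCOPING A18) on the NEGATIVE coupling axis, where the cell has no
certificate; it discharges nothing else and certifies no number.

## Content

`G` compact metrisable, `ρ : G → M_N(ℂ)` continuous (`N ≥ 1`) with a central scalar
`ρ z = ω • 1`, `ω ≠ 1` (`SU(N)`, `N ≥ 2`; `U(N)`, `N ≥ 1`), `d ≥ 2`, `β < 0`.

* ★★★ **`false_of_translationInvariant_haarShift_diagRP_of_neg`** — NO probability measure on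
  `LGConfig d G` is simultaneously translation invariant, a one-link Haar-shift (DLR / Schwinger–
  Dyson) state of the Wilson action at coupling `β`, and reflection positive in every diagonal
  mirror `x_i = x_j`. In particular
  **`ClassBState.false_of_neg`** / **`isEmpty_classBState_of_neg`**: `ClassBState d ρ β` is empty;
* ★★ **`not_torusLimitPointsDiagonalRP_of_neg`**, **`not_thermodynamicLimitIsClassB_of_neg`** —
  the two OPEN propositions of `ClassB.lean` are FALSE on the negative axis: infinite-volume limit
  points of the torus Wilson states exist (tree), are translation invariant Haar-shift states
  (tree, `ClassBLimitPoints`), hence at `β < 0` some diagonal RP fails for each of them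
  (`exists_not_diagRP_of_mem_infiniteVolumeLimitPoints_of_neg`);
* instances `…_suN` (`N ≥ 2`), `…_uN` (`N ≥ 1`) for the matrix groups.

## Proof (three tree-level facts and one inequality)

(1) Diagonal RP + translation invariance ⇒ `u_p = ∫ Re tr ρ(U_p) dμ ≥ 0` for every plaquette
(`ClassBState.integral_plaquetteObs_nonneg`, `CutLoopCharacterPositivity.lean`).
(2) The Haar-shift identity with the trivial observable `f = 1` and `g = z^{±1}`:
`∫ exp(-β Δ_{z^{±1}}) dμ = 1`, `Δ_g(U) = S_e(U[e ↦ g⁻¹U_e]) - S_e(U)`; since `e^x ≥ 1 + x` and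
`-β > 0`: `∫ Δ_{z^{±1}} dμ ≤ 0`.
(3) `ρ(z^{±1})` is the scalar `ω^{±1}` and every plaquette through `e` contains `e` exactly once, so
`Re tr ρ(U_p[e ↦ zU_e]) + Re tr ρ(U_p[e ↦ z⁻¹U_e]) = 2 Re ω · Re tr ρ(U_p)`
(`re_trace_hol_update_add`, part 1/2 `ClassBNegativeCouplingShift.lean`), whence POINTWISE
`Δ_z + Δ_{z⁻¹} = 2 (1 - Re ω) Σ_{p ∋ e} Re tr ρ(U_p)` (`shiftAction_add_shiftAction_inv`), whose
mean is `≥ 0` by (1). Hence `∫ Δ_z dμ = 0`, so `∫ (e^{-βΔ_z} - 1 + βΔ_z) dμ = 0` with a non-negative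
continuous cylinder integrand.
(4) Haar-shift states charge every cylinder (`HaarShiftSupport.lean`): the integrand vanishes
IDENTICALLY, so `Δ_z ≡ 0`, likewise `Δ_{z⁻¹} ≡ 0`, so `Σ_{p ∋ e} Re tr ρ(U_p) ≡ 0` — false at
`U ≡ 1` (value `#{p ∋ e} · N > 0`).

## What is NOT claimed

Nothing at `β ≥ 0` (there Class B is inhabited in the uniqueness windows, `ClassBStrongCoupling`);
nothing for representations without a non-trivial central scalar; nothing about which single
axiom fails for a given limit point beyond "some diagonal RP". Elementary; not in print as far as
the cell's searches go (the positivity `u_p ≥ 0` under RP is folklore, Osterwalder–Seiler 1978 §2).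
-/

open MeasureTheory Complex Finset Function
open scoped ComplexOrder

namespace Summit.QuantumFields.GaugeBoot

open Literature.MathematicalPhysics.QuantumFieldTheory (haarProbability IsSpecialUnitaryModel
  IsUnitaryModel)
open Literature.MathematicalPhysics.QuantumLattice
open Literature.RepresentationTheory.CompactGroups

noncomputable section

variable {d N : ℕ} {G : Type*} [Group G] [TopologicalSpace G] [IsTopologicalGroup G]
  [CompactSpace G] [MeasurableSpace G] [BorelSpace G] (ρ : G →* Matrix (Fin N) (Fin N) ℂ)

/-! ## The contradiction -/

section Main

variable [NeZero N] [SecondCountableTopology G]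

/-- ★★★ **No translation-invariant, diagonally reflection-positive Haar-shift state exists at
`β < 0`.** `G` compact metrisable; `ρ` continuous, `N ≥ 1`, with a central scalar `ρ z = ω • 1`,
`ω ≠ 1`; `d ≥ 2`; `β < 0`; `μ` a probability measure on `LGConfig d G` which is translation
invariant, satisfies the one-link Haar-shift identity at coupling `β`, and is reflection positive
in every diagonal mirror `x_i = x_j` (`i ≠ j`). Then `False`. -/
theorem false_of_translationInvariant_haarShift_diagRP_of_neg (hρ : Continuous ρ) {z : G} {ω : ℂ}
    (hz : ρ z = ω • (1 : Matrix (Fin N) (Fin N) ℂ)) (hω : ω ≠ 1) (hd : 2 ≤ d) {β : ℝ} (hβ : β < 0)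
    {μ : Measure (LGConfig d G)} [IsProbabilityMeasure μ] (hT : IsZdTranslationInvariant μ)
    (hH : IsHaarShiftState ρ β μ)
    (hRP : ∀ i j : Fin d, i ≠ j →
      IsReflectionPositiveFor (configDiagSwapZd (G := G) i j) (diagHalfEdges i j) μ) : False := by
  classical
  -- a link `e = (0, i₀)` and the plaquettes through it
  obtain ⟨i₀, j₀, hij⟩ : ∃ i j : Fin d, i ≠ j :=
    ⟨⟨0, by omega⟩, ⟨1, by omega⟩, by simp [Fin.ext_iff]⟩
  set e : ZdEdge d := ((0 : Fin d → ℤ), i₀) with he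
  set P := plaquettesTouching ({e} : Finset (ZdEdge d)) with hP
  set A : LGConfig d G → ℝ := fun U => ∑ p ∈ P, plaquetteObs ρ p.1 p.2.1.1 p.2.1.2 U with hA
  set Δ : G → LGConfig d G → ℝ := fun g U =>
    wilsonBoundaryAction ρ {e} (Function.update U e (g⁻¹ * U e)) - wilsonBoundaryAction ρ {e} U
    with hΔ
  have hω1 : ‖ω‖ = 1 := norm_eq_one_of_map_eq_smul_one ρ hρ hz
  have hreω : ω.re < 1 := by
    have h1 : ω.re ≤ 1 := (Complex.re_le_norm ω).trans hω1.le
    refine lt_of_le_of_ne h1 fun hre => hω ?_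
    have hsq : ω.re * ω.re + ω.im * ω.im = 1 := by
      rw [← Complex.normSq_apply, Complex.normSq_eq_norm_sq, hω1, one_pow]
    have him : ω.im = 0 := by
      have : ω.im * ω.im = 0 := by rw [hre] at hsq; linarith
      exact mul_self_eq_zero.1 this
    exact Complex.ext (by simp [hre]) (by simp [him])
  -- (1) every plaquette has non-negative mean: `∫ A ≥ 0`
  have hA0 : 0 ≤ ∫ U, A U ∂μ := by
    simp only [hA]
    rw [integral_finsetSum _ fun p _ =>
      integrable_of_continuous_real (continuous_plaquetteObs ρ hρ _ _ _) μ]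
    refine Finset.sum_nonneg fun p _ => ?_
    -- translation invariance moves the plaquette to the origin of its plane
    have hp : p.2.1.1 ≠ p.2.1.2 := ne_of_lt p.2.2
    have h0 := integral_re_trace_plaquette_nonneg_of_isReflectionPositiveFor_diag ρ hρ hp
      (hRP _ _ hp)
    have hTr : ∫ U, plaquetteObs ρ p.1 p.2.1.1 p.2.1.2 U ∂μ =
        ∫ U, (ρ (plaquetteHolonomyZd U 0 p.2.1.1 p.2.1.2)).trace.re ∂μ := by
      conv_lhs => rw [← hT p.1]
      rw [integral_map_equiv]
      refine integral_congr_ae (ae_of_all _ fun U => ?_)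
      have h := plaquetteHolonomyZd_configShift_add p.1 U 0 p.2.1.1 p.2.1.2
      rw [zero_add] at h
      simp only [plaquetteObs, h]
    rw [hTr]
    exact h0
  -- (2) `∫ Δ_z ≤ 0`, `∫ Δ_{z⁻¹} ≤ 0`
  have hz1 := hH.integral_shiftAction_nonpos ρ hρ hβ e z
  have hz2 := hH.integral_shiftAction_nonpos ρ hρ hβ e z⁻¹
  -- (3) pointwise `Δ_z + Δ_{z⁻¹} = 2(1 - Re ω) A`
  have hsum : ∀ U, Δ z U + Δ z⁻¹ U = 2 * (1 - ω.re) * A U :=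
    fun U => shiftAction_add_shiftAction_inv ρ hρ hz e U
  have hΔc : ∀ g, Continuous (Δ g) := fun g => continuous_shiftAction ρ hρ e g
  have hΔi : ∀ g, Integrable (Δ g) μ := fun g => integrable_of_continuous_real (hΔc g) μ
  have hint_sum : ∫ U, Δ z U ∂μ + ∫ U, Δ z⁻¹ U ∂μ = 2 * (1 - ω.re) * ∫ U, A U ∂μ := by
    rw [← integral_add (hΔi z) (hΔi z⁻¹), ← integral_const_mul]
    exact integral_congr_ae (ae_of_all _ hsum)
  have hΔz : ∫ U, Δ z U ∂μ = 0 := by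
    have hpos : 0 ≤ 2 * (1 - ω.re) * ∫ U, A U ∂μ := by
      have : 0 < 1 - ω.re := by linarith
      positivity
    change ∫ U, Δ z U ∂μ ≤ 0 at hz1
    change ∫ U, Δ z⁻¹ U ∂μ ≤ 0 at hz2
    linarith
  have hΔz' : ∫ U, Δ z⁻¹ U ∂μ = 0 := by
    have hpos : 0 ≤ 2 * (1 - ω.re) * ∫ U, A U ∂μ := by
      have : 0 < 1 - ω.re := by linarith
      positivity
    change ∫ U, Δ z U ∂μ ≤ 0 at hz1
    change ∫ U, Δ z⁻¹ U ∂μ ≤ 0 at hz2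
    linarith
  -- (4) the convexity defect `exp(-βΔ) - 1 + βΔ ≥ 0` has zero mean, hence vanishes identically
  have hvanish : ∀ g : G, ∫ U, Δ g U ∂μ = 0 → ∀ U, Δ g U = 0 := by
    intro g hg U
    set h : LGConfig d G → ℝ := fun U => Real.exp (-(β * Δ g U)) - 1 - (-β) * Δ g U with hh
    have hhc : Continuous h :=
      ((Real.continuous_exp.comp (((hΔc g).const_mul β).neg)).sub continuous_const).sub
        ((hΔc g).const_mul _)
    have hh0 : ∀ U, 0 ≤ h U := fun U => by
      have := Real.add_one_le_exp (-(β * Δ g U))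
      simp only [hh]; linarith
    have hhS := isCylinder_shiftAction ρ e g
    have hhcyl : IsCylinder h (insert e ((plaquettesTouching ({e} : Finset (ZdEdge d))).biUnion
        plaquetteEdges)) := fun U V hUV => by
      have h1 : Δ g U = Δ g V := hhS hUV
      simp only [hh, h1]
    have hi1 : Integrable (fun U => Real.exp (-(β * Δ g U))) μ :=
      integrable_of_continuous_real (Real.continuous_exp.comp (((hΔc g).const_mul β).neg)) μ
    have hi2 : Integrable (fun U => Real.exp (-(β * Δ g U)) - 1) μ := hi1.sub (integrable_const _)
    have hi3 : Integrable (fun U => -β * Δ g U) μ := (hΔi g).const_mul _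
    have hexp : ∫ U, Real.exp (-(β * Δ g U)) ∂μ = 1 := hH.integral_exp_shiftAction ρ e g
    have hhint : ∫ U, h U ∂μ = 0 := by
      simp only [hh]
      rw [integral_sub hi2 hi3, integral_sub hi1 (integrable_const _), integral_const_mul, hg,
        integral_const, probReal_univ, hexp]
      simp
    haveI : NeZero μ := ⟨IsProbabilityMeasure.ne_zero μ⟩
    have hzero := IsHaarShiftState.eq_zero_of_integral_eq_zero hH hhcyl hhc hh0 hhint
    have hU : h U = 0 := by rw [hzero]; rfl
    -- `exp x = 1 + x` forces `x = 0`
    by_contra hne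
    have hx : -(β * Δ g U) ≠ 0 := by
      intro h0
      have : β * Δ g U = 0 := by linarith
      rcases mul_eq_zero.1 this with h' | h'
      · exact (ne_of_lt hβ) h'
      · exact hne h'
    have hlt := Real.add_one_lt_exp hx
    simp only [hh] at hU
    linarith
  have hz0 : ∀ U, Δ z U = 0 := hvanish z hΔz
  have hz0' : ∀ U, Δ z⁻¹ U = 0 := hvanish z⁻¹ hΔz'
  -- hence `A ≡ 0`; evaluate at the trivial configuration
  have hA1 : A (fun _ => (1 : G)) = 0 := by
    have h := hsum (fun _ => (1 : G))
    rw [hz0, hz0', add_zero] at h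
    have hne : (2 : ℝ) * (1 - ω.re) ≠ 0 := by
      have : 0 < 1 - ω.re := by linarith
      positivity
    exact (mul_eq_zero.1 h.symm).resolve_left hne
  -- but `A(1) = #P · N > 0`
  have hobs1 : ∀ p : ZdPlaquette d, plaquetteObs ρ p.1 p.2.1.1 p.2.1.2 (fun _ => (1 : G)) = N :=
    fun p => by
    simp [plaquetteObs, plaquetteHolonomyZd, Matrix.trace_one]
  have hcard : A (fun _ => (1 : G)) = (P.card : ℝ) * N := by
    simp only [hA, hobs1, Finset.sum_const, nsmul_eq_mul]
  -- a plaquette through `e`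
  have hPne : P.Nonempty := by
    rcases lt_or_gt_of_ne hij with hlt | hlt
    · refine ⟨((0 : Fin d → ℤ), ⟨(i₀, j₀), hlt⟩), mem_plaquettesTouching_iff.2 ⟨e, ?_⟩⟩
      simp [he, plaquetteEdges]
    · refine ⟨((0 : Fin d → ℤ), ⟨(j₀, i₀), hlt⟩), mem_plaquettesTouching_iff.2 ⟨e, ?_⟩⟩
      simp [he, plaquetteEdges]
  have hN : (0 : ℝ) < N := by exact_mod_cast Nat.pos_of_ne_zero (NeZero.ne N)
  have hPpos : (0 : ℝ) < P.card := by exact_mod_cast Finset.card_pos.2 hPne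
  have : (0 : ℝ) < A (fun _ => (1 : G)) := by rw [hcard]; positivity
  linarith

/-- ★★★ **CLASS B IS EMPTY AT NEGATIVE COUPLING.** For `G` compact metrisable, `ρ` continuous
(`N ≥ 1`) with a central scalar `ρ z = ω • 1`, `ω ≠ 1`, `d ≥ 2` and `β < 0`, there is no Class-B
state: the Kazakov–Zheng infinite-volume axioms (translation invariance, one-link Schwinger–Dyson,
diagonal reflection positivity) are inconsistent. Only these three axioms are used. -/
theorem ClassBState.false_of_neg (hρ : Continuous ρ) {z : G} {ω : ℂ}
    (hz : ρ z = ω • (1 : Matrix (Fin N) (Fin N) ℂ)) (hω : ω ≠ 1) (hd : 2 ≤ d) {β : ℝ} (hβ : β < 0)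
    (w : ClassBState d ρ β) : False := by
  haveI := w.isProbabilityMeasure
  exact false_of_translationInvariant_haarShift_diagRP_of_neg ρ hρ hz hω hd hβ
    w.translationInvariant w.haarShift w.diagRP

/-- ★★★ `ClassBState d ρ β` is an empty type for `β < 0` (central scalar `ω ≠ 1`, `d ≥ 2`). -/
theorem isEmpty_classBState_of_neg (hρ : Continuous ρ) {z : G} {ω : ℂ}
    (hz : ρ z = ω • (1 : Matrix (Fin N) (Fin N) ℂ)) (hω : ω ≠ 1) (hd : 2 ≤ d) {β : ℝ} (hβ : β < 0) :
    IsEmpty (ClassBState d ρ β) :=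
  ⟨fun w => ClassBState.false_of_neg ρ hρ hz hω hd hβ w⟩

/-- ★★ **Every infinite-volume limit point of the torus Wilson states violates some diagonal RP at
`β < 0`** (they are translation-invariant Haar-shift states, tree). -/
theorem exists_not_diagRP_of_mem_infiniteVolumeLimitPoints_of_neg [NeZero d] [T2Space G]
    (hρ : Continuous ρ) {z : G} {ω : ℂ} (hz : ρ z = ω • (1 : Matrix (Fin N) (Fin N) ℂ))
    (hω : ω ≠ 1) (hd : 2 ≤ d) {β : ℝ} (hβ : β < 0) {μ : Measure (LGConfig d G)}
    (hμ : μ ∈ infiniteVolumeLimitPoints (d := d) ρ β) :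
    ∃ i j : Fin d, i ≠ j ∧
      ¬ IsReflectionPositiveFor (configDiagSwapZd (G := G) i j) (diagHalfEdges i j) μ := by
  obtain ⟨hprob, htrans, -, -, hhaar⟩ := classBInvariances_of_mem_infiniteVolumeLimitPoints ρ hρ hμ
  by_contra h
  push Not at h
  exact false_of_translationInvariant_haarShift_diagRP_of_neg ρ hρ hz hω hd hβ htrans hhaar h

/-- ★★ **`TorusLimitPointsDiagonalRP` is FALSE at `β < 0`** (limit points exist, tree
`infiniteVolumeLimitPoints_nonempty_holds`). -/
theorem not_torusLimitPointsDiagonalRP_of_neg [NeZero d] [T2Space G] (hρ : Continuous ρ)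
    {z : G} {ω : ℂ} (hz : ρ z = ω • (1 : Matrix (Fin N) (Fin N) ℂ)) (hω : ω ≠ 1) (hd : 2 ≤ d)
    {β : ℝ} (hβ : β < 0) : ¬ TorusLimitPointsDiagonalRP d ρ β := by
  intro h
  obtain ⟨μ, hμ⟩ := infiniteVolumeLimitPoints_nonempty_holds (d := d) ρ hρ β
  obtain ⟨i, j, hij, hnot⟩ :=
    exists_not_diagRP_of_mem_infiniteVolumeLimitPoints_of_neg ρ hρ hz hω hd hβ hμ
  exact hnot (h μ hμ i j hij)

/-- ★★ **`ThermodynamicLimitIsClassB` is FALSE at `β < 0`.** -/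
theorem not_thermodynamicLimitIsClassB_of_neg [NeZero d] [T2Space G] (hρ : Continuous ρ)
    {z : G} {ω : ℂ} (hz : ρ z = ω • (1 : Matrix (Fin N) (Fin N) ℂ)) (hω : ω ≠ 1) (hd : 2 ≤ d)
    {β : ℝ} (hβ : β < 0) : ¬ ThermodynamicLimitIsClassB d ρ β := by
  intro h
  obtain ⟨μ, hμ⟩ := infiniteVolumeLimitPoints_nonempty_holds (d := d) ρ hρ β
  obtain ⟨w, -⟩ := h μ hμ
  exact ClassBState.false_of_neg ρ hρ hz hω hd hβ w

end Main

/-! ## The concrete groups -/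

section Groups

open Literature.MathematicalPhysics.QuantumFieldTheory in
/-- ★★★ **`SU(N)`, `N ≥ 2`, `d ≥ 2`, `β < 0`: Class B is empty, and `ThermodynamicLimitIsClassB`
fails.** -/
theorem isEmpty_classBState_of_neg_suN {d N : ℕ} (hd : 2 ≤ d) (hN : 2 ≤ N) {β : ℝ} (hβ : β < 0) :
    IsEmpty (ClassBState d (fundamentalRep (Fin N)) β) := by
  haveI : NeZero N := ⟨by omega⟩
  haveI : SecondCountableTopology (Matrix (Fin N) (Fin N) ℂ) :=
    inferInstanceAs (SecondCountableTopology (Fin N → Fin N → ℂ))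
  haveI : SecondCountableTopology (Matrix.specialUnitaryGroup (Fin N) ℂ) :=
    Topology.IsEmbedding.subtypeVal.secondCountableTopology
  obtain ⟨z, ζ, hζ1, hz, -⟩ := IsSpecialUnitaryModel.exists_central (fundamentalRep (Fin N))
    (TorusAreaLaw.isSpecialUnitaryModel_fundamentalRep N) hN
  exact isEmpty_classBState_of_neg (fundamentalRep (Fin N)) (continuous_fundamentalRep (Fin N))
    hz hζ1 hd hβ

open Literature.MathematicalPhysics.QuantumFieldTheory in
/-- ★★★ **`SU(N)`: `ThermodynamicLimitIsClassB d (fundamentalRep (Fin N)) β` is false for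
`β < 0`** (`N ≥ 2`, `d ≥ 2`). -/
theorem not_thermodynamicLimitIsClassB_of_neg_suN {d N : ℕ} [NeZero d] (hd : 2 ≤ d) (hN : 2 ≤ N)
    {β : ℝ} (hβ : β < 0) : ¬ ThermodynamicLimitIsClassB d (fundamentalRep (Fin N)) β := by
  haveI : NeZero N := ⟨by omega⟩
  haveI : SecondCountableTopology (Matrix (Fin N) (Fin N) ℂ) :=
    inferInstanceAs (SecondCountableTopology (Fin N → Fin N → ℂ))
  haveI : SecondCountableTopology (Matrix.specialUnitaryGroup (Fin N) ℂ) :=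
    Topology.IsEmbedding.subtypeVal.secondCountableTopology
  obtain ⟨z, ζ, hζ1, hz, -⟩ := IsSpecialUnitaryModel.exists_central (fundamentalRep (Fin N))
    (TorusAreaLaw.isSpecialUnitaryModel_fundamentalRep N) hN
  exact not_thermodynamicLimitIsClassB_of_neg (fundamentalRep (Fin N))
    (continuous_fundamentalRep (Fin N)) hz hζ1 hd hβ

open Literature.MathematicalPhysics.QuantumFieldTheory in
/-- ★★★ **`U(N)`, `N ≥ 1` (`N = 1`: compact `U(1)`), `d ≥ 2`, `β < 0`: Class B is empty.** -/
theorem isEmpty_classBState_of_neg_uN {d N : ℕ} (hd : 2 ≤ d) (hN : 1 ≤ N) {β : ℝ} (hβ : β < 0) :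
    IsEmpty (ClassBState d (unitaryFundamentalRep (Fin N) ℂ) β) := by
  haveI : NeZero N := ⟨by omega⟩
  haveI : SecondCountableTopology (Matrix.unitaryGroup (Fin N) ℂ) :=
    IsUnitaryModel.secondCountableTopology _ (isUnitaryModel_unitaryFundamentalRep N)
  obtain ⟨z, hz, -⟩ := IsUnitaryModel.exists_central (unitaryFundamentalRep (Fin N) ℂ)
    (isUnitaryModel_unitaryFundamentalRep N)
  have hz' : unitaryFundamentalRep (Fin N) ℂ z = (-1 : ℂ) • (1 : Matrix (Fin N) (Fin N) ℂ) := by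
    rw [hz, neg_one_smul]
  exact isEmpty_classBState_of_neg (unitaryFundamentalRep (Fin N) ℂ)
    (continuous_unitaryFundamentalRep (Fin N) ℂ) hz' (by norm_num) hd hβ

open Literature.MathematicalPhysics.QuantumFieldTheory in
/-- ★★★ **`U(N)`: `ThermodynamicLimitIsClassB` is false for `β < 0`** (`N ≥ 1`, `d ≥ 2`). -/
theorem not_thermodynamicLimitIsClassB_of_neg_uN {d N : ℕ} [NeZero d] (hd : 2 ≤ d) (hN : 1 ≤ N)
    {β : ℝ} (hβ : β < 0) : ¬ ThermodynamicLimitIsClassB d (unitaryFundamentalRep (Fin N) ℂ) β := by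
  haveI : NeZero N := ⟨by omega⟩
  haveI : SecondCountableTopology (Matrix.unitaryGroup (Fin N) ℂ) :=
    IsUnitaryModel.secondCountableTopology _ (isUnitaryModel_unitaryFundamentalRep N)
  obtain ⟨z, hz, -⟩ := IsUnitaryModel.exists_central (unitaryFundamentalRep (Fin N) ℂ)
    (isUnitaryModel_unitaryFundamentalRep N)
  have hz' : unitaryFundamentalRep (Fin N) ℂ z = (-1 : ℂ) • (1 : Matrix (Fin N) (Fin N) ℂ) := by
    rw [hz, neg_one_smul]
  exact not_thermodynamicLimitIsClassB_of_neg (unitaryFundamentalRep (Fin N) ℂ)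
    (continuous_unitaryFundamentalRep (Fin N) ℂ) hz' (by norm_num) hd hβ

end Groups

end

end Summit.QuantumFields.GaugeBoot
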